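import Summits.QuantumFields.YangMills.Theorems.FlatTubeReductionBOAssemblySlowRate
import Summits.QuantumFields.YangMills.Theorems.LuscherReductionTwistedTraceScalingBOAssemblyFloor
import HarnessLib

/-!
# The FLOOR-WITH-RATE clause of the rate-grade Born–Oppenheimer tube package from its bricks (adapted fibres, dressed one-site form) — rate twin of lane A's `…BOAssemblyFloor`
# (route `FlatTubeReduction`, crux K1 `NearFlatRatioLaw` stmt-QuantumFields-24720; seat `ym-line-ftr-p1` g9; R2b1 RECORD rung — no summit statement is proved here)

At a fixed `β`, the FLOOR clause `e^{−ελ/4}·σ·μ₀(L³β) ≤ λ₀(β,L)` of `RateTube.SoftTubeBORatePackageOn` follows, exactly as in lane A's `floor_clause_of_bricks` (p647445), from a ONE-SITE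
near-top amplitude `φ₀` (bounded measurable, supported in `𝒰`) with `⟨φ₀W, K_Bφ₀W⟩ ≥ e^{−ε''λ}μ₀‖φ₀‖²` — at rate grade this is `Quasimode.exists_concentrated_quasimode_levelValue` (p647846)
transported to `φ₀ := φ/W` (`Lines/borate-floor-g9.md`), a HYPOTHESIS here —, the (B-T)-RATE LOWER kernel brick for `boFunAd φ₀ Ω` against the dressed form, the (B-N) fibre-mass
brick, `tubeForm_le_levelValue_zero` (p645288) and `28·crossBound ≤ ε_t·λ_b·λ₀`; plus lane A's `arith_floor`-shape inequality.  Exponents are real parameters (rate instance: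
`ε := Cλ_b`, `ε'' := C''λ_b`, `ε_t := λ_b`).
* ★ `tubeNormSq_boFunAd_le` — `‖boFunAd φ Ω‖²_w ≤ Γ·∫φ²` when `fibreMassAd ≤ Γ` on `𝒰 ⊇ supp φ`;
* ★★★ `floor_rate_clause_of_bricks`.
HONEST FRAMING: assembly algebra for the rate twin of a stub of a child of the CONDITIONAL reduction route R2b1; the bricks are OPEN; not a gap, not Clay.  No defs, no `sorry`.
-/

set_option autoImplicit false

noncomputable section

open MeasureTheory Filter Topology Real
open scoped BigOperators
open Literature.MathematicalPhysics.QuantumFieldTheory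
open Literature.MathematicalPhysics.QuantumLattice

namespace Summit.QuantumFields.YangMills.Theorems.FemtoTransferGap.RateTube

open Summit.QuantumFields.YangMills.Theorems.FemtoTransferGap
open Summit.QuantumFields.YangMills.Theorems.FemtoTransferGap.TwoLattice.Avg
open Summit.QuantumFields.YangMills.Theorems.FemtoTransferGap.TwoLattice.ConstTube
open Summit.QuantumFields.YangMills.Theorems.FemtoTransferGap.TwoLattice.Stiff (LinkSpace)

variable {L : ℕ} [NeZero L]

/-! ## §1 The weighted norm of a BO function against the fibre-mass brick -/

/-- ★ `‖boFunAd φ Ω‖²_w ≤ γ(1+κ)·∫φ²` when `fibreMassAd ≤ γ(1+κ)` on `𝒰 ⊇ supp φ`. [folklore] -/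
theorem tubeNormSq_boFunAd_le {φ : GaugeConfig 3 1 SU2 → ℝ} (hφ : Measurable φ) {Cφ : ℝ} (hCφ : ∀ u, |φ u| ≤ Cφ) {Ω : GaugeConfig 3 1 SU2 → LinkSpace L → ℝ} (hΩ : Measurable (Function.uncurry Ω)) {CΩ : ℝ}
    (hCΩ : ∀ u x, |Ω u x| ≤ CΩ) {w : GaugeConfig 3 L SU2 → ℝ} (hw : Measurable w) {Cw : ℝ} (hCw : ∀ U, |w U| ≤ Cw) {𝒰 : Set (GaugeConfig 3 1 SU2)}
    (hφs : ∀ u, φ u ≠ 0 → u ∈ 𝒰) {Γ : ℝ} (hΓ : ∀ u ∈ 𝒰, fibreMassAd L w Ω u ≤ Γ) :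
    tubeNormSq w (boFunAd L φ Ω) ≤ Γ * ∫ u, φ u ^ 2 ∂configMeasure SU2 1 := by
  haveI := isFiniteMeasure_orthoTransverse L
  rw [tubeNormSq_boFunAd hφ hCφ hΩ hCΩ hw hCw, ← integral_const_mul]
  have hCΩ0 : 0 ≤ CΩ := (abs_nonneg _).trans (hCΩ 1 0)
  have hM := measurable_fibreMassAd hw hΩ (L := L)
  have hMb : ∀ u, |fibreMassAd L w Ω u| ≤ CΩ ^ 2 * Cw * (orthoTransverse L).real Set.univ := fun u => by
    unfold fibreMassAd
    calc |∫ v, Ω u (linkEmbed L v) ^ 2 * w (orthoTube L u v) ∂orthoTransverse L| ≤ ∫ v, |Ω u (linkEmbed L v) ^ 2 * w (orthoTube L u v)| ∂orthoTransverse L :=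
          abs_integral_le_integral_abs
      _ ≤ ∫ _v, CΩ ^ 2 * Cw ∂orthoTransverse L := by
          refine integral_mono_of_nonneg (ae_of_all _ fun v => abs_nonneg _) (integrable_const _) (ae_of_all _ fun v => ?_)
          show |Ω u (linkEmbed L v) ^ 2 * w (orthoTube L u v)| ≤ CΩ ^ 2 * Cw
          rw [abs_mul, abs_pow]
          exact mul_le_mul (pow_le_pow_left₀ (abs_nonneg _) (hCΩ _ _) 2) (hCw _) (abs_nonneg _) (by positivity)
      _ = CΩ ^ 2 * Cw * (orthoTransverse L).real Set.univ := by rw [integral_const, smul_eq_mul, mul_comm]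
  have hiL : Integrable (fun u => φ u ^ 2 * fibreMassAd L w Ω u) (configMeasure SU2 1) :=
    integrable_of_measurable_abs_le _ ((hφ.pow_const 2).mul hM) (C := Cφ ^ 2 * (CΩ ^ 2 * Cw * (orthoTransverse L).real Set.univ)) fun u => by
      rw [abs_mul, abs_pow]; exact mul_le_mul (pow_le_pow_left₀ (abs_nonneg _) (hCφ u) 2) (hMb u) (abs_nonneg _) (by positivity)
  have hiR : Integrable (fun u => Γ * φ u ^ 2) (configMeasure SU2 1) :=
    (integrable_of_measurable_abs_le _ (hφ.pow_const 2) (C := Cφ ^ 2) fun u => by rw [abs_pow]; exact pow_le_pow_left₀ (abs_nonneg _) (hCφ u) 2).const_mul _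
  refine integral_mono hiL hiR fun u => ?_
  dsimp only
  by_cases hu : u ∈ 𝒰
  · have := hΓ u hu; nlinarith [sq_nonneg (φ u)]
  · have h0 : φ u = 0 := by by_contra h; exact hu (hφs u h)
    rw [h0]; simp

/-! ## §2 ★★★ The FLOOR clause from the bricks -/

/-- ★★★ **FLOOR CLAUSE FROM THE BRICKS (fixed `β`)**: `e^{−ελ/4}·σ·μ₀(L³β) ≤ λ₀(β, L)`. [cite: Luscher1983, §3] [cite: ReedSimonIV1978, Thm. XIII.1] -/
theorem floor_rate_clause_of_bricks {β : ℝ} (hβ : 0 ≤ β) {χ : GaugeConfig 3 L SU2 → ℝ} (hχ : Measurable χ) {Cχ : ℝ} (hCχ : ∀ U, |χ U| ≤ Cχ) (hχ0 : ∀ U, 0 ≤ χ U)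
    {c : ℝ} (hc : 0 < c) (hcχ : ∀ U, χ U ≠ 0 → c ≤ χ U) (hwm : Measurable (softWeight χ)) {Cw : ℝ} (hCw : ∀ U, |softWeight χ U| ≤ Cw)
    {Ω : GaugeConfig 3 1 SU2 → LinkSpace L → ℝ} (hΩ : Measurable (Function.uncurry Ω)) {CΩ : ℝ} (hCΩ : ∀ u x, |Ω u x| ≤ CΩ)
    {𝒰 : Set (GaugeConfig 3 1 SU2)} {δ₂ m : ℝ} (hm : 0 ≤ m) (hLδm : (L : ℝ) * (δ₂ + m) < 2)
    (hsupp : ∀ (φ : GaugeConfig 3 1 SU2 → ℝ) (U : GaugeConfig 3 L SU2), (∀ u, φ u ≠ 0 → u ∈ 𝒰) → boFunAd L φ Ω U ≠ 0 → χ U ≠ 0 ∧ orbitDist U < δ₂)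
    {σ γ κ : ℝ} (hσ : 0 ≤ σ) (hγ : 0 < γ) (hκ0 : 0 ≤ κ) (hκ1 : κ ≤ 1)
    (hN : ∀ u ∈ 𝒰, |fibreMassAd L (softWeight χ) Ω u - γ| ≤ κ * γ)
    {φ₀ : GaugeConfig 3 1 SU2 → ℝ} (hφm : Measurable φ₀) {C₀ : ℝ} (hC₀ : ∀ u, |φ₀ u| ≤ C₀) (hφs : ∀ u, φ₀ u ≠ 0 → u ∈ 𝒰) (hφpos : 0 < l2 φ₀ φ₀)
    {W : GaugeConfig 3 1 SU2 → ℝ} {ε ε'' εt : ℝ}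
    (hφtop : Real.exp (-(ε'' * bareLambda ((L : ℝ) ^ 3 * β))) * levelValue su2Rep 1 ((L : ℝ) ^ 3 * β) 0 * l2 φ₀ φ₀ ≤
      qform su2Rep ((L : ℝ) ^ 3 * β) (fun u => φ₀ u * W u) (fun u => φ₀ u * W u))
    (hTlow : σ * γ * (1 - κ) * qform su2Rep ((L : ℝ) ^ 3 * β) (fun u => φ₀ u * W u) (fun u => φ₀ u * W u) -
      κ * σ * γ * levelValue su2Rep 1 ((L : ℝ) ^ 3 * β) 0 * l2 φ₀ φ₀ ≤ tubeForm β (boFunAd L φ₀ Ω))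
    (hcB : 28 * crossBound L β m ≤ εt * bareLambda ((L : ℝ) ^ 3 * β) * levelValue su2Rep L β 0) (hεt : 0 ≤ εt)
    (hμ0 : 0 ≤ levelValue su2Rep 1 ((L : ℝ) ^ 3 * β) 0)
    (harith : Real.exp (-(ε / 4 * bareLambda ((L : ℝ) ^ 3 * β))) * ((1 + εt * bareLambda ((L : ℝ) ^ 3 * β) / 4) * (1 + κ)) ≤
      (1 - κ) * Real.exp (-(ε'' * bareLambda ((L : ℝ) ^ 3 * β))) - κ) :
    Real.exp (-(ε / 4 * bareLambda ((L : ℝ) ^ 3 * β))) * (σ * levelValue su2Rep 1 ((L : ℝ) ^ 3 * β) 0) ≤ levelValue su2Rep L β 0 := by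
  set B : ℝ := (L : ℝ) ^ 3 * β with hB
  set μ0 : ℝ := levelValue su2Rep 1 B 0 with hμ0def
  set lam : ℝ := bareLambda B with hlamdef
  set Λ0 : ℝ := levelValue su2Rep L β 0 with hΛ0def
  set f₀ : GaugeConfig 3 L SU2 → ℝ := boFunAd L φ₀ Ω with hf₀
  have hlam0 : 0 ≤ lam := by
    rw [hlamdef]; unfold bareLambda; exact Real.rpow_nonneg (by positivity) _
  have hΛ0 : 0 ≤ Λ0 := levelValue_su2Rep_nonneg L hβ 0
  -- the floor glue on `f₀`
  have hf₀m : Measurable f₀ := measurable_boFunAd L hφm hΩ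
  have hf₀b := abs_boFunAd_le L hC₀ hCΩ (Ω := Ω) (φ := φ₀)
  have hf₀χ : ∀ U, χ U = 0 → f₀ U = 0 := fun U hU => by
    by_contra h; exact (hsupp φ₀ U hφs h).1 hU
  have hf₀δ : ∀ U, f₀ U ≠ 0 → orbitDist U < δ₂ := fun U h => (hsupp φ₀ U hφs h).2
  have hFL := tubeForm_le_levelValue_zero hβ hm hLδm hf₀m hf₀b hχ hCχ hχ0 hc hcχ hf₀χ hf₀δ
  -- the norm of `f₀`
  have hΓ : ∀ u ∈ 𝒰, fibreMassAd L (softWeight χ) Ω u ≤ γ * (1 + κ) := fun u hu => by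
    have := (abs_le.mp (hN u hu)).2; linarith
  have hn : tubeNormSq (softWeight χ) f₀ ≤ γ * (1 + κ) * l2 φ₀ φ₀ := by
    rw [l2_self_eq_integral_sq]; exact tubeNormSq_boFunAd_le hφm hC₀ hΩ hCΩ hwm hCw hφs hΓ
  -- chain: σγ[(1−κ)e^{−ε''λ} − κ]μ₀ ‖φ₀‖² ≤ T(f₀) ≤ (Λ₀ + 7cB)·γ(1+κ)‖φ₀‖²
  set n : ℝ := l2 φ₀ φ₀ with hndef
  set q : ℝ := qform su2Rep B (fun u => φ₀ u * W u) (fun u => φ₀ u * W u) with hqdef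
  set e'' : ℝ := Real.exp (-(ε'' * lam)) with he''
  have hA0 : 0 ≤ σ * γ * (1 - κ) := mul_nonneg (mul_nonneg hσ hγ.le) (by linarith)
  have h1 : σ * γ * μ0 * n * ((1 - κ) * e'' - κ) ≤ tubeForm β f₀ := by
    have hq : σ * γ * (1 - κ) * (e'' * μ0 * n) ≤ σ * γ * (1 - κ) * q := mul_le_mul_of_nonneg_left hφtop hA0
    have e1 : σ * γ * μ0 * n * ((1 - κ) * e'' - κ) = σ * γ * (1 - κ) * (e'' * μ0 * n) - κ * σ * γ * μ0 * n := by ring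
    rw [e1]; linarith [hq, hTlow]
  have hcB0 : 0 ≤ crossBound L β m := (crossBound_pos β m).le
  have h2 : tubeForm β f₀ ≤ (Λ0 + 7 * crossBound L β m) * (γ * (1 + κ) * n) :=
    hFL.trans (mul_le_mul_of_nonneg_left hn (by positivity))
  have h3 : (Λ0 + 7 * crossBound L β m) * (γ * (1 + κ) * n) ≤ Λ0 * (1 + εt * lam / 4) * (γ * (1 + κ) * n) := by
    refine mul_le_mul_of_nonneg_right ?_ (by positivity)
    have : 7 * crossBound L β m ≤ εt * lam * Λ0 / 4 := by linarith [hcB]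
    nlinarith [this]
  -- divide by `γ n > 0`
  have hγn : 0 < γ * n := mul_pos hγ hφpos
  have h4 : σ * μ0 * ((1 - κ) * e'' - κ) ≤ Λ0 * ((1 + εt * lam / 4) * (1 + κ)) := by
    have h := (h1.trans h2).trans h3
    have e1 : σ * γ * μ0 * n * ((1 - κ) * e'' - κ) = (σ * μ0 * ((1 - κ) * e'' - κ)) * (γ * n) := by ring
    have e2 : Λ0 * (1 + εt * lam / 4) * (γ * (1 + κ) * n) = (Λ0 * ((1 + εt * lam / 4) * (1 + κ))) * (γ * n) := by ring
    rw [e1, e2] at h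
    exact le_of_mul_le_mul_right h hγn
  -- the arithmetic hypothesis, multiplied by `σ μ0 ≥ 0`
  set D : ℝ := (1 + εt * lam / 4) * (1 + κ) with hDdef
  have hD : 0 < D := by rw [hDdef]; positivity
  have h5 : Real.exp (-(ε / 4 * lam)) * D * (σ * μ0) ≤ ((1 - κ) * e'' - κ) * (σ * μ0) :=
    mul_le_mul_of_nonneg_right harith (mul_nonneg hσ hμ0)
  have h6 : Real.exp (-(ε / 4 * lam)) * (σ * μ0) * D ≤ Λ0 * D := by
    have e1 : Real.exp (-(ε / 4 * lam)) * (σ * μ0) * D = Real.exp (-(ε / 4 * lam)) * D * (σ * μ0) := by ring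
    have e2 : ((1 - κ) * e'' - κ) * (σ * μ0) = σ * μ0 * ((1 - κ) * e'' - κ) := by ring
    rw [e1]; rw [e2] at h5; exact h5.trans h4
  exact le_of_mul_le_mul_right h6 hD

end Summit.QuantumFields.YangMills.Theorems.FemtoTransferGap.RateTube

end
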